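import Summits.NavierStokesRegularity.NavierStokesRegularity.Theses.WakeRatchet

/-!
# LINE g10-2 (ideator ns-idea-1 g10) — `stub_wakeLimit` of LINE g10-1 PROVED: FINAL WAKES EXIST

For every admissible eternal solution `W` of the renormalised inviscid lattice of a CANCELLING table at
scale ratio `1+ε₀ > 1` and every shell `k`, the physical shell energy
`physEnergy ε₀ W k σ = Λ^{-2k} e^{2σ}‖W_k(σ)‖² = ‖X_k(t)‖²` has a LIMIT as `σ → ∞` (`t → T*`): the final
wake `ω_k`.  Proof: the physical energy identity `E_k' = F_{k-1} − F_k` (`hasDerivAt_physEnergy` at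
`ν̂ = 0`), the flux bound `|F_j| ≤ 2 C_A Λ⁻¹ ‖W_{j+1}‖ E_j` (`abs_physFlux_le`), the forward bound of
`IsEternal.bdd` on `E_{k-1}, E_k` and the finite action `∫‖W_j‖ < ∞` of `IsEternal.action` make `E_k'`
integrable on a right half-line, so `E_k` converges (`tendsto_limUnder_of_hasDerivAt_of_integrableOn_Ioi`).
This is the registered stub `stub_wakeLimit` of the skeleton of record `final_wake_line.lean`
(FinalWakeLedger, crux ⟨stmt-NavierStokesRegularity-25646⟩ `WakeRatchet.EternalInviscidRate`), same
namespace, same name, same signature; sorry-free.  Model lattice ODEs only; nothing about NS.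
No summit is proved by a line.
-/

set_option linter.dupNamespace false

open Filter Topology MeasureTheory Set
open Literature.Analysis.FluidPDE.TaoCascade

namespace Summit.NavierStokesRegularity.NavierStokesRegularity.Cruxes.EternalInviscidRate.FinalWakeLedger

/-- On the forward half-line of `IsEternal.bdd`, the physical energy of shell `j` is bounded by
`Λ^{-2j} P_j`. -/
theorem physEnergy_le_of_bdd {m : ℕ} {ε₀ : ℝ} {W : ℤ → ℝ → Em m} {j : ℤ} {σ₀ P : ℝ}
    (h : ∀ σ, σ₀ ≤ σ → Real.exp (2 * σ) * ‖W j σ‖ ^ 2 ≤ P) {σ : ℝ} (hσ : σ₀ ≤ σ) :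
    physEnergy ε₀ W j σ ≤ (bigLam ε₀ ^ j)⁻¹ ^ 2 * P := by
  unfold physEnergy
  exact mul_le_mul_of_nonneg_left (h σ hσ) (sq_nonneg _)

/-- **`stub_wakeLimit` (LINE g10-1, FinalWakeLedger) — PROVED.**  Final wakes exist. -/
theorem stub_wakeLimit : ∀ ε₀ : ℝ, 0 < ε₀ → ∀ α : Fin 4 → Fin 4 → Fin 4 → ℤ × ℤ × ℤ → ℝ, IsCancellingCoeff α → ∀ W : ℤ → ℝ → Em 4, IsEternal ε₀ α W → ∀ k : ℤ, ∃ L : ℝ, Tendsto (physEnergy ε₀ W k) atTop (𝓝 L) := by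
  intro ε₀ hε α hc W hW k
  have hWv : IsEternalVisc ε₀ 0 α W := hW.isEternalVisc
  -- the derivative of `E_k` at `ν̂ = 0`
  set f' : ℝ → ℝ := fun σ => physFlux ε₀ α W (k - 1) σ - physFlux ε₀ α W k σ with hf'
  have hder : ∀ σ, HasDerivAt (physEnergy ε₀ W k) (f' σ) σ := by
    intro σ
    have h := hasDerivAt_physEnergy hε hWv hc k σ
    refine h.congr_deriv ?_
    simp [hf', viscCoef]
  -- constants
  have hΛ : 0 < bigLam ε₀ := bigLam_pos (by linarith)
  have hCA : 0 ≤ fluxConst α := fluxConst_nonneg α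
  set c : ℝ := 2 * fluxConst α * (bigLam ε₀)⁻¹ with hc_def
  have hc0 : 0 ≤ c := by rw [hc_def]; positivity
  obtain ⟨σ₁, P₁, hP₁⟩ := hW.bdd (k - 1)
  obtain ⟨σ₂, P₂, hP₂⟩ := hW.bdd k
  obtain ⟨Mact, hact⟩ := hW.action
  set a : ℝ := max σ₁ σ₂ with ha
  set B₁ : ℝ := (bigLam ε₀ ^ (k - 1))⁻¹ ^ 2 * P₁ with hB₁
  set B₂ : ℝ := (bigLam ε₀ ^ k)⁻¹ ^ 2 * P₂ with hB₂
  -- dominating function: `c B₁ ‖W_k‖ + c B₂ ‖W_{k+1}‖`, integrable by the finite action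
  set g : ℝ → ℝ := fun σ => c * B₁ * ‖W k σ‖ + c * B₂ * ‖W (k + 1) σ‖ with hg
  have hg_int : Integrable g := by
    have h1 : Integrable (fun σ => c * B₁ * ‖W k σ‖) := ((hact k).1).const_mul (c * B₁)
    have h2 : Integrable (fun σ => c * B₂ * ‖W (k + 1) σ‖) := ((hact (k + 1)).1).const_mul (c * B₂)
    exact h1.add h2
  -- pointwise domination on `Ioi a`
  have hdom : ∀ σ ∈ Ioi a, ‖f' σ‖ ≤ g σ := by
    intro σ hσ
    have hσ₁ : σ₁ ≤ σ := (le_max_left _ _).trans (le_of_lt hσ)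
    have hσ₂ : σ₂ ≤ σ := (le_max_right _ _).trans (le_of_lt hσ)
    have hE₁ : physEnergy ε₀ W (k - 1) σ ≤ B₁ := physEnergy_le_of_bdd hP₁ hσ₁
    have hE₂ : physEnergy ε₀ W k σ ≤ B₂ := physEnergy_le_of_bdd hP₂ hσ₂
    have hF₁ : |physFlux ε₀ α W (k - 1) σ| ≤ c * ‖W k σ‖ * physEnergy ε₀ W (k - 1) σ := by
      have h := abs_physFlux_le hε hc W (k - 1) σ
      simp only [sub_add_cancel] at h
      simpa [hc_def, mul_assoc] using h
    have hF₂ : |physFlux ε₀ α W k σ| ≤ c * ‖W (k + 1) σ‖ * physEnergy ε₀ W k σ := by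
      have h := abs_physFlux_le hε hc W k σ
      simpa [hc_def, mul_assoc] using h
    have hck : 0 ≤ c * ‖W k σ‖ := mul_nonneg hc0 (norm_nonneg _)
    have hck1 : 0 ≤ c * ‖W (k + 1) σ‖ := mul_nonneg hc0 (norm_nonneg _)
    have h1 : |physFlux ε₀ α W (k - 1) σ| ≤ c * B₁ * ‖W k σ‖ := by
      calc |physFlux ε₀ α W (k - 1) σ| ≤ c * ‖W k σ‖ * physEnergy ε₀ W (k - 1) σ := hF₁
        _ ≤ c * ‖W k σ‖ * B₁ := mul_le_mul_of_nonneg_left hE₁ hck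
        _ = c * B₁ * ‖W k σ‖ := by ring
    have h2 : |physFlux ε₀ α W k σ| ≤ c * B₂ * ‖W (k + 1) σ‖ := by
      calc |physFlux ε₀ α W k σ| ≤ c * ‖W (k + 1) σ‖ * physEnergy ε₀ W k σ := hF₂
        _ ≤ c * ‖W (k + 1) σ‖ * B₂ := mul_le_mul_of_nonneg_left hE₂ hck1
        _ = c * B₂ * ‖W (k + 1) σ‖ := by ring
    calc ‖f' σ‖ = |physFlux ε₀ α W (k - 1) σ - physFlux ε₀ α W k σ| := by
          rw [hf', Real.norm_eq_abs]
      _ ≤ |physFlux ε₀ α W (k - 1) σ| + |physFlux ε₀ α W k σ| := abs_sub _ _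
      _ ≤ c * B₁ * ‖W k σ‖ + c * B₂ * ‖W (k + 1) σ‖ := add_le_add h1 h2
      _ = g σ := by rw [hg]
  -- measurability of `f'` (it is the derivative of `E_k`)
  have hf'_eq : f' = deriv (physEnergy ε₀ W k) := by
    funext σ; exact ((hder σ).deriv).symm
  have hf'_meas : AEStronglyMeasurable f' (volume.restrict (Ioi a)) := by
    rw [hf'_eq]
    exact (measurable_deriv _).aestronglyMeasurable
  have hint : IntegrableOn f' (Ioi a) := by
    refine Integrable.mono' hg_int.integrableOn hf'_meas ?_
    exact (ae_restrict_iff' measurableSet_Ioi).mpr (ae_of_all _ hdom)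
  exact ⟨_, tendsto_limUnder_of_hasDerivAt_of_integrableOn_Ioi (fun σ _ => hder σ) hint⟩

/-- **Function form of `stub_wakeLimit`** (the composition's `choose`): an admissible eternal solution of a
cancelling table at scale ratio `1+ε₀ > 1` HAS a final-wake function `ω : ℤ → ℝ` — `E_k(σ) → ω k` as `σ → ∞`
for every shell `k` — and every final wake is non-negative.  Model lattice ODEs only; nothing about NS. -/
theorem exists_finalWakes {ε₀ : ℝ} (hε : 0 < ε₀) {α : Fin 4 → Fin 4 → Fin 4 → ℤ × ℤ × ℤ → ℝ}
    (hc : IsCancellingCoeff α) {W : ℤ → ℝ → Em 4} (hW : IsEternal ε₀ α W) :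
    ∃ ω : ℤ → ℝ, (∀ k : ℤ, Tendsto (physEnergy ε₀ W k) atTop (𝓝 (ω k))) ∧ ∀ k : ℤ, 0 ≤ ω k := by
  choose ω hω using stub_wakeLimit ε₀ hε α hc W hW
  exact ⟨ω, hω, fun k => ge_of_tendsto' (hω k) fun σ => physEnergy_nonneg _ _ _ _⟩

end Summit.NavierStokesRegularity.NavierStokesRegularity.Cruxes.EternalInviscidRate.FinalWakeLedger
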